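import Mathlib.GroupTheory.Archimedean
import Summits.NavierStokesRegularity.NavierStokesRegularity.Theorems.QuantisedSymmetryPolyhedralDssProfileExistsStubPeriodWindow
import Literature.Analysis.FluidPDE.TypeIAncientMild
import Literature.Analysis.FluidPDE.SelfSimilar
import HarnessLib

/-!
# The self-similarity group of a witness is infinite cyclic — crux stmt-NavierStokesRegularity-1404
  (`QuantisedSymmetry.PolyhedralDssProfileExists`), line polyhedral_cell,
  stub stub_dssGroupCyclic (N23)

Registered stub `stub_dssGroupCyclic` (`--supports stmt-NavierStokesRegularity-1404`). Let `V` be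
a Type-I ancient mild field in the Oseen gauge (`IsTypeIAncientMild C V`) with the space–time
Type-I bound `HasTypeIDecay C₀ V`, exactly `c`-DSS for some `c > 1`, and not identically zero on
the past. Then there is a MINIMAL factor `c₀ > 1` with `V` `c₀`-DSS, and the positive reals `μ`
for which `V` is `μ`-DSS are exactly the integer powers `c₀ ^ k`, `k ∈ ℤ`.

Proof sketch.
* `0 < C₀`: `0 < ‖V t x‖ ≤ C₀ / (‖x‖ + √(-t))` at the nontrivial point.
* The slice `V t` is continuous (`IsTypeIAncientMild.continuous_slice`), so `V t x ≠ 0` forbids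
  `V t =ᵐ 0` (`Measure.eq_of_ae_eq`).
* The landed period window N1 (`stub_periodWindow`, Chae–Wolf 2017 Thm 1.3) applied to `V`
  (an ancient mild solution with measurable slices, `IsTypeIAncientMild.isAncientMildSolution`,
  `.aestronglyMeasurable_slice`) gives `c₁ = c₁(C₀) > 1` with NO DSS factor of `V` in `(1, c₁)`.
* `H := {s : ℝ | IsDiscretelySelfSimilar (exp s) V}` is an additive subgroup of `ℝ`
  (`nsRescale_one`, `IsDiscretelySelfSimilar.mul`, `nsRescale_inv_nsRescale`),
  `log c ∈ H \ {0}`, and `Disjoint H (Ioo 0 (log c₁))`; Mathlib's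
  `AddSubgroup.exists_isLeast_pos` and `AddSubgroup.cyclic_of_min` give `H = ℤ b` with `b > 0`
  least; `c₀ := exp b`, and `exp (k • b) = (exp b) ^ k`.
-/

noncomputable section

-- the summit namespace `…NavierStokesRegularity.NavierStokesRegularity…` is the tree convention (D-0017)
set_option linter.dupNamespace false

namespace Summit.NavierStokesRegularity.NavierStokesRegularity.Theorems.PolyhedralDssProfileExists.PolyhedralCell

open MeasureTheory Set Function Filter Topology
open Literature.Analysis Literature.Analysis.FluidPDE

/-! ### Two elementary lemmas -/

/-- **Inverse factor.** If `u` is exactly `c`-DSS with `c ≠ 0`, it is exactly `c⁻¹`-DSS: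
`nsRescale c⁻¹ u = nsRescale c⁻¹ (nsRescale c u) = u` (group law of the parabolic rescaling).
[folklore] -/
theorem dssGroupCyclic_dss_inv
    {u : ℝ → EuclideanSpace ℝ (Fin 3) → EuclideanSpace ℝ (Fin 3)} {c : ℝ} (hc : c ≠ 0)
    (h : IsDiscretelySelfSimilar c u) : IsDiscretelySelfSimilar c⁻¹ u := by
  have key := nsRescale_inv_nsRescale hc u
  rw [show nsRescale c u = u from h] at key
  exact key

/-- **Integer powers of the exponential**: `exp (k • b) = (exp b) ^ k` for `k ∈ ℤ`. [folklore] -/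
theorem dssGroupCyclic_exp_zsmul (k : ℤ) (b : ℝ) : Real.exp (k • b) = Real.exp b ^ k := by
  rw [zsmul_eq_mul, mul_comm, Real.exp_mul, Real.rpow_intCast]

/-! ### The abstract cyclicity statement -/

/-- **Cyclicity from a factor gap.** If `u` is exactly `c`-DSS for some `c > 1` and has NO DSS
factor in a window `(1, c₁)`, `c₁ > 1`, then its positive DSS factors are exactly the integer
powers of a minimal factor `c₀ > 1`: the additive group `H = {s : ℝ | u is (exp s)-DSS} ⊆ ℝ`
(closed under `+` by `exp (a + b) = exp a · exp b` and `IsDiscretelySelfSimilar.mul`, under `-`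
by `exp (-a) = (exp a)⁻¹` and `dssGroupCyclic_dss_inv`, `exp 0 = 1` and `nsRescale_one`) is
nontrivial (`log c ≠ 0`) and `0` is isolated in it (`Disjoint H (Ioo 0 (log c₁))`), hence it is
`ℤ b` for its least positive element `b` (Mathlib `AddSubgroup.exists_isLeast_pos`,
`AddSubgroup.cyclic_of_min`); `c₀ = exp b`, `exp (k • b) = (exp b) ^ k`. [folklore] -/
theorem dssGroupCyclic_of_gap {u : ℝ → EuclideanSpace ℝ (Fin 3) → EuclideanSpace ℝ (Fin 3)}
    {c c₁ : ℝ} (hc : 1 < c) (hdss : IsDiscretelySelfSimilar c u) (hc₁ : 1 < c₁)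
    (hgap : ∀ μ : ℝ, 1 < μ → μ < c₁ → ¬ IsDiscretelySelfSimilar μ u) :
    ∃ c₀ : ℝ, 1 < c₀ ∧ IsDiscretelySelfSimilar c₀ u ∧
      ∀ μ : ℝ, 0 < μ → (IsDiscretelySelfSimilar μ u ↔ ∃ k : ℤ, μ = c₀ ^ k) := by
  have hc0 : 0 < c := one_pos.trans hc
  -- the additive group of logarithms of DSS factors
  set H : AddSubgroup ℝ :=
    { carrier := {s | IsDiscretelySelfSimilar (Real.exp s) u}
      add_mem' := fun {a b} ha hb => by
        change IsDiscretelySelfSimilar (Real.exp (a + b)) u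
        rw [Real.exp_add]
        exact IsDiscretelySelfSimilar.mul ha hb
      zero_mem' := by
        change IsDiscretelySelfSimilar (Real.exp 0) u
        rw [Real.exp_zero]
        exact nsRescale_one u
      neg_mem' := fun {a} ha => by
        change IsDiscretelySelfSimilar (Real.exp (-a)) u
        rw [Real.exp_neg]
        exact dssGroupCyclic_dss_inv (Real.exp_pos a).ne' ha } with hHdef
  have hmem : ∀ s, s ∈ H ↔ IsDiscretelySelfSimilar (Real.exp s) u := fun s => Iff.rfl
  have hlog : ∀ μ, 0 < μ → (Real.log μ ∈ H ↔ IsDiscretelySelfSimilar μ u) := fun μ hμ => by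
    rw [hmem, Real.exp_log hμ]
  -- `log c` is a nonzero element
  have hlogc : Real.log c ∈ H := (hlog c hc0).2 hdss
  have hbot : H ≠ ⊥ := fun h => (Real.log_pos hc).ne' (AddSubgroup.mem_bot.1 (h ▸ hlogc))
  -- `0` is isolated: no element in `(0, log c₁)`
  have hdisj : Disjoint (H : Set ℝ) (Ioo 0 (Real.log c₁)) := by
    rw [Set.disjoint_left]
    rintro s (hs : IsDiscretelySelfSimilar (Real.exp s) u) ⟨hs0, hs1⟩
    refine hgap (Real.exp s) (Real.one_lt_exp_iff.2 hs0) ?_ hs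
    calc Real.exp s < Real.exp (Real.log c₁) := Real.exp_lt_exp.2 hs1
      _ = c₁ := Real.exp_log (one_pos.trans hc₁)
  obtain ⟨b, hb⟩ := AddSubgroup.exists_isLeast_pos hbot (Real.log_pos hc₁) hdisj
  have hHb : H = AddSubgroup.closure {b} := AddSubgroup.cyclic_of_min hb
  obtain ⟨⟨hbH, hbpos⟩, -⟩ := hb
  have hzmem : ∀ k : ℤ, k • b ∈ H := fun k => H.zsmul_mem hbH k
  refine ⟨Real.exp b, Real.one_lt_exp_iff.2 hbpos, (hmem b).1 hbH, fun μ hμ => ?_⟩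
  constructor
  · intro hμdss
    have hlogμ : Real.log μ ∈ AddSubgroup.closure {b} := hHb ▸ (hlog μ hμ).2 hμdss
    obtain ⟨k, hk⟩ := AddSubgroup.mem_closure_singleton.1 hlogμ
    refine ⟨k, ?_⟩
    rw [← dssGroupCyclic_exp_zsmul, hk, Real.exp_log hμ]
  · rintro ⟨k, rfl⟩
    rw [← dssGroupCyclic_exp_zsmul]
    exact (hmem _).1 (hzmem k)

/-! ### The registered stub -/

/-- **REGISTERED STUB `stub_dssGroupCyclic` (N23): the self-similarity group of a nontrivial Type-I
ancient solution is infinite cyclic.** Let `V` be a Type-I ancient mild field in the Oseen gauge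
with the space–time Type-I bound `HasTypeIDecay C₀ V`, `c`-DSS for some `c > 1`, and not
identically zero on the past. Then there is a minimal factor `c₀ > 1` with `V` `c₀`-DSS, and the
positive reals `μ` for which `V` is `μ`-DSS are exactly the integer powers `c₀ ^ k`, `k ∈ ℤ`.
Proof: `C₀ > 0` and `¬ V t =ᵐ 0` at the nontrivial (continuous) slice; the landed period window
`stub_periodWindow` (Chae–Wolf 2017, Thm 1.3) excludes every DSS factor of `V` in `(1, c₁(C₀))`;
`dssGroupCyclic_of_gap` (subgroups of `ℝ` with `0` isolated are cyclic).
[cite: ChaeWolf2017RemovingDSS, Theorem 1.3] -/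
theorem stub_dssGroupCyclic :
    ∀ (V : ℝ → EuclideanSpace ℝ (Fin 3) → EuclideanSpace ℝ (Fin 3)) (C C₀ c : ℝ),
      IsTypeIAncientMild C V → HasTypeIDecay C₀ V → 1 < c → IsDiscretelySelfSimilar c V →
      (∃ t < 0, ∃ x, V t x ≠ 0) →
      ∃ c₀ : ℝ, 1 < c₀ ∧ IsDiscretelySelfSimilar c₀ V ∧
        ∀ μ : ℝ, 0 < μ → (IsDiscretelySelfSimilar μ V ↔ ∃ k : ℤ, μ = c₀ ^ k) := by
  intro V C C₀ c hV hdec hc hdss hnt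
  obtain ⟨t, ht, x, hx⟩ := hnt
  -- (0) the Type-I constant is positive
  have hden : 0 < ‖x‖ + Real.sqrt (-t) :=
    add_pos_of_nonneg_of_pos (norm_nonneg _) (Real.sqrt_pos.2 (neg_pos.2 ht))
  have hC₀ : 0 < C₀ := by
    have h1 : 0 < C₀ / (‖x‖ + Real.sqrt (-t)) := (norm_pos_iff.2 hx).trans_le (hdec t ht x)
    by_contra hle
    exact (not_le.2 h1) (div_nonpos_of_nonpos_of_nonneg (not_lt.1 hle) hden.le)
  -- (1) the nontrivial slice is not a.e. zero (it is continuous)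
  have hnae : ¬ (V t =ᵐ[volume] (0 : EuclideanSpace ℝ (Fin 3) → EuclideanSpace ℝ (Fin 3))) := by
    intro hae
    have hVt : V t = 0 := Measure.eq_of_ae_eq hae (hV.continuous_slice ht) continuous_const
    exact hx (by rw [hVt, Pi.zero_apply])
  -- (2) the period window: no DSS factor in `(1, c₁)`
  obtain ⟨c₁, hc₁, hwin⟩ := stub_periodWindow C₀ hC₀
  have hgap : ∀ μ : ℝ, 1 < μ → μ < c₁ → ¬ IsDiscretelySelfSimilar μ V :=
    fun μ hμ hμ₁ hμdss =>
      hnae (hwin μ V hμ hμ₁ hV.isAncientMildSolution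
        (fun s hs => hV.aestronglyMeasurable_slice hs) hμdss hdec t ht)
  -- (3)-(4) cyclicity from the gap
  exact dssGroupCyclic_of_gap hc hdss hc₁ hgap

end Summit.NavierStokesRegularity.NavierStokesRegularity.Theorems.PolyhedralDssProfileExists.PolyhedralCell

end
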